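import Mathlib

/-!
# The lattice diamagnetic inequality of Brydges–Fröhlich–Seiler, Gaussian case — PROVED
(`LatticeDiamagneticInequality`)

statement-level skeleton of published theorems with citation tags; proofs where landed; nothing here is a claim about the Yang–Mills mass gap

THE RESULT.  Let a finite lattice (any finite multigraph: sites `ι`, bonds `β`, `src, tgt : β → ι`) carry an
`N`-component field `φ : ι → 𝕜ⁿ` (`𝕜 = ℝ` or `ℂ`, internal index `n`), let every bond `b` carry a UNITARY
(for `𝕜 = ℝ`: orthogonal) parallel transporter `U_b`, a hopping weight `w_b ≥ 0`, and every site a mass /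
boundary weight `c_x` with `c_x > Σ_{b ∋ x} w_b` (strict diagonal dominance, i.e. a strictly positive mass term).
The gauge-covariant lattice operator ("minimal coupling")

  `⟨φ, M_U φ⟩ = Σ_x c_x |φ(x)|² − Σ_b w_b (⟨φ(src b), U_b φ(tgt b)⟩ + ⟨φ(tgt b), U_b^* φ(src b)⟩)`

(for `c_x = Σ_{b∋x} w_b + m²` this is `Σ_b w_b |U_b φ(tgt b) − φ(src b)|² + m² Σ_x |φ(x)|²`, i.e.
`⟨φ, (−Δ_U + m²) φ⟩` with the covariant lattice Laplacian `−Δ_U = D_U^* D_U`, Neumann on the given bond set)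
satisfies the **diamagnetic inequality**

  `det M_U ≥ det M_1 > 0`,  equivalently  `∫ dφ e^{−½⟨φ, M_U φ⟩} ≤ ∫ dφ e^{−½⟨φ, M_1 φ⟩}`        (∗)

(`M_1` = the same operator with all `U_b = 1`): switching on a gauge field can only DECREASE the Gaussian
(free, minimally coupled) partition function.  (The Gaussian-integral form of (∗) for `𝕜 = ℝ` is the one-line
consequence of `∫ e^{−½⟨φ,Mφ⟩}dφ = (2π)^{dim/2} (det M)^{−1/2}` and is spelled out, on the (Higgs)₂,₃ carrier of
[Balaban1982Higgs1], in the companion `Balaban1983to89.B2Ineq338Diamagnetic`; the present file is pure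
finite-dimensional linear algebra and imports only Mathlib.)

SOURCE AND STATUS OF THE CITATION.  The inequality is the "diamagnetic inequality" of D. Brydges, J. Fröhlich,
E. Seiler, *On the construction of quantized gauge fields. I. General results*, Ann. Phys. **121** (1979) 227–284
[BrydgesFrohlichSeiler1979] (reference [5] of [Balaban1982Higgs1], "[I.5]" of [Balaban1982Higgs2]).  That source is
NOT HELD by this project (acquisition request acq-09341 open; `run/shared/lean/pub/lit-balaban/MISSING-SOURCES.md`),
so NO locator inside it is asserted and NOTHING in this file rests on it: every statement below is PROVED.  What IS
held and was read (page render `pub-balaban/b2b-balaban-ref1/pages/1982-cmp86-higgs23-II/…-p037-x2.png`, read as an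
image) is the place where T. Bałaban INVOKES it — *(Higgs)₂,₃ quantum fields in a finite volume. II. An upper bound*,
Commun. Math. Phys. **86** (1982) 555–594 [Balaban1982Higgs2], p. 591: the last covariant Gaussian integral
`∫dφ₀ exp(−½⟨φ₀,(−Δ^ε_{A^ε}+m²)φ₀⟩)` (3.37) is bounded by *"We apply the “diamagnetic inequality” of paper [I.5] to
this integral, and we estimate it by `∫dφ exp(−½⟨φ,(−Δ^ε+m²)φ⟩) = exp(E_{0,s})`. (3.38)"* — which is (∗) for the
covariant Laplacian of the `N`-component real scalar field on the torus `T_ε` with `U(A_b) = exp(eεqA_b) ∈ O(N)`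
([Balaban1982Higgs1] (1.7) p. 605) and `m² > 0`.  A held modern treatment of the same mechanism (abelian case, as a
loop expansion with non-negative coefficients) is A. Chandra, I. Chevyrev, *Gauge field marginal of an Abelian Higgs
model*, Commun. Math. Phys. (2024), arXiv:2207.05443, §§3–4 (`paper:arxiv-2207.05443`).

THE PROOF FORMALISED (the classical random-walk / loop route, in finite dimension; no source is followed line by line
since none is held — the argument is standard and is given here in full).
1. `M_U = D^{½}(1 − S_U)D^{½}` with `D = diag(c) ⊗ 1` and the normalised hopping matrix `S_U` (bond weights
   `s_b = w_b/√(c_{src b} c_{tgt b})`), so `det M_U = (Π_{(x,i)} c_x) · det(1 − S_U)` (`coupling_eq_conj`,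
   `det_coupling_eq`; the bond-by-bond form of `⟨v, M_U v⟩` displayed above is `quadForm_coupling`).
2. `S_U` is Hermitian (`isHermitian_hop`) and, by the Cauchy–Schwarz and AM–GM inequalities bond by bond,
   `|⟨v, S_U v⟩| ≤ Σ_x (Σ_{b∋x} w_b / c_x)‖v_x‖²` (`norm_quadForm_hop_normalize_le`), which is `< ‖v‖²` under strict
   dominance; hence all eigenvalues `λ_i` of `S_U` satisfy `|λ_i| < 1` (`abs_eigenvalues_lt_one`).
3. Spectral theorem: `det(1 − S) = Π_i (1 − λ_i)` and `Tr(S^k) = Σ_i λ_i^k` (`det_one_sub_eq_prod`, `trace_pow_eq_sum`),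
   so by the logarithmic series `−log Π_i(1 − λ_i) = Σ_{k≥1} (Σ_i λ_i^k)/k` (`hasSum_neg_log_prod_one_sub`).
4. THE DIAMAGNETIC STEP (`re_trace_pow_hop_le`): `Re Tr(S_U^k) ≤ Tr(S_1^k)`.  Blockwise, `(S_U^k)_{xy}` is a sum over
   walks `x = x₀, x₁, …, x_k = y` of `Π s_{b_i} ·` (a product of `k` unitaries), and a product of unitaries has every
   matrix element of modulus `≤ 1`; formally: the `n × n` blocks of `S_U^k` are dominated, as sesquilinear forms, by
   the entries of the `k`-th power of the scalar weight matrix `t_{xy} = Σ_{b : x—y} s_b` (`dom_blk_pow`), whose trace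
   times `|n|` is exactly `Tr(S_1^k)` (`blk_pow_free`, `re_trace_pow_free`, `re_trace_pow_le_free`).
5. Hence `Π_i(1 − λ_i(S_1)) ≤ Π_i(1 − λ_i(S_U))` (`prod_one_sub_eigenvalues_free_le`), i.e. `det M_1 ≤ det M_U`
   (`det_coupling_free_le`: `Re det M_1 ≤ Re det M_U`, the determinants being real, `im_det_coupling`; real
   orthogonal form `det_coupling_free_le_real`); both operators are positive definite (`posDef_coupling`,
   `det_coupling_pos`).  Everything is stated for an arbitrary `RCLike` field `𝕜`, arbitrary finite index types
   `ι` (sites), `β` (bonds), `n` (components), arbitrary weights under `Hopping.StrictDom`.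

Unit `lit-balaban-p28` (Phase-2 proof seat p28, gen 4) of the lit-balaban cell, HOME `run/shared/lean/pub/lit-balaban/`
(node `EXT:BFS1979` of the cell's DEPGRAPH; row B2.Eq3.32 member (3.38)).
-/

namespace Literature.MathematicalPhysics.QuantumFieldTheory.LatticeDiamagneticInequality

open Matrix Finset
open scoped ComplexOrder InnerProductSpace

/-! ## §1. Blocks of matrices indexed by `ι × n` -/

section Blocks

variable {R : Type*} [CommRing R] {ι n : Type*} [Fintype ι] [Fintype n] [DecidableEq ι] [DecidableEq n]

/-- The `(x, y)` block (an `n × n` matrix) of a matrix indexed by `ι × n`. [folklore] -/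
def blk (M : Matrix (ι × n) (ι × n) R) (x y : ι) : Matrix n n R := of fun i j => M (x, i) (y, j)

omit [CommRing R] [Fintype ι] [Fintype n] [DecidableEq ι] [DecidableEq n] in
/-- Entries of a block. [folklore] -/
@[simp] private theorem blk_apply (M : Matrix (ι × n) (ι × n) R) (x y : ι) (i j : n) : blk M x y i j = M (x, i) (y, j) := rfl

omit [DecidableEq ι] [DecidableEq n] in
/-- Blocks of a product: `(MN)_{xy} = Σ_z M_{xz} N_{zy}`. [folklore] -/
private theorem blk_mul (M N : Matrix (ι × n) (ι × n) R) (x y : ι) :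
    blk (M * N) x y = ∑ z, blk M x z * blk N z y := by
  ext i j
  simp only [blk_apply, mul_apply, Matrix.sum_apply]
  exact Fintype.sum_prod_type _

omit [Fintype ι] [Fintype n] in
/-- Blocks of the identity. [folklore] -/
private theorem blk_one (x y : ι) : blk (1 : Matrix (ι × n) (ι × n) R) x y = if x = y then 1 else 0 := by
  ext i j
  simp only [blk_apply, one_apply, Prod.mk.injEq]
  by_cases h : x = y
  · subst h; simp [one_apply]
  · simp [h]

omit [Fintype ι] [Fintype n] [DecidableEq ι] [DecidableEq n] in
/-- Blocks of a sum. [folklore] -/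
private theorem blk_add (M N : Matrix (ι × n) (ι × n) R) (x y : ι) : blk (M + N) x y = blk M x y + blk N x y := by
  ext i j; simp

omit [Fintype ι] [Fintype n] [DecidableEq ι] [DecidableEq n] in
/-- Blocks of a difference. [folklore] -/
private theorem blk_sub (M N : Matrix (ι × n) (ι × n) R) (x y : ι) : blk (M - N) x y = blk M x y - blk N x y := by
  ext i j; simp

omit [Fintype ι] [Fintype n] [DecidableEq ι] [DecidableEq n] in
/-- Blocks of a scalar multiple. [folklore] -/
private theorem blk_smul (r : R) (M : Matrix (ι × n) (ι × n) R) (x y : ι) : blk (r • M) x y = r • blk M x y := by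
  ext i j; simp

omit [Fintype ι] [Fintype n] [DecidableEq ι] [DecidableEq n] in
/-- Blocks of a finite sum. [folklore] -/
private theorem blk_sum {α : Type*} (s : Finset α) (M : α → Matrix (ι × n) (ι × n) R) (x y : ι) :
    blk (∑ a ∈ s, M a) x y = ∑ a ∈ s, blk (M a) x y := by
  ext i j; simp [Matrix.sum_apply]

omit [DecidableEq ι] [DecidableEq n] in
/-- The trace is the sum of the traces of the diagonal blocks. [folklore] -/
private theorem trace_eq_sum_trace_blk (M : Matrix (ι × n) (ι × n) R) : trace M = ∑ x, trace (blk M x x) := by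
  simp only [trace, diag_apply, blk_apply]
  rw [Fintype.sum_prod_type]

/-- The matrix on `ι × n` whose only nonzero block is `A`, placed at `(x, y)` (`= E_{xy} ⊗ A`). [folklore] -/
def placed (x y : ι) (A : Matrix n n R) : Matrix (ι × n) (ι × n) R :=
  of fun p q => if x = p.1 ∧ y = q.1 then A p.2 q.2 else 0

omit [Fintype ι] [Fintype n] [DecidableEq n] in
/-- Entries of a placed block. [folklore] -/
@[simp] private theorem placed_apply (x y : ι) (A : Matrix n n R) (p q : ι × n) :
    placed x y A p q = if x = p.1 ∧ y = q.1 then A p.2 q.2 else 0 := rfl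

omit [Fintype ι] [Fintype n] [DecidableEq n] in
/-- Blocks of a placed matrix. [folklore] -/
private theorem blk_placed (x y : ι) (A : Matrix n n R) (x' y' : ι) :
    blk (placed x y A) x' y' = if x = x' ∧ y = y' then A else 0 := by
  ext i j
  simp only [blk_apply, placed_apply]
  split_ifs <;> rfl

omit [Fintype ι] [Fintype n] [DecidableEq n] in
/-- `placed` is linear in the block. [folklore] -/
private theorem placed_smul (x y : ι) (r : R) (A : Matrix n n R) : placed x y (r • A) = r • placed x y A := by
  ext p q
  simp only [placed_apply, Matrix.smul_apply, smul_eq_mul, mul_ite, mul_zero]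

omit [Fintype ι] [Fintype n] [DecidableEq n] in
/-- The conjugate transpose of a placed block: `E_{xy}(A)^* = E_{yx}(A^*)`. [folklore] -/
private theorem conjTranspose_placed [StarRing R] (x y : ι) (A : Matrix n n R) : (placed x y A)ᴴ = placed y x Aᴴ := by
  ext p q
  simp only [conjTranspose_apply, placed_apply]
  by_cases h : x = q.1 ∧ y = p.1
  · rw [if_pos h, if_pos ⟨h.2, h.1⟩]
  · rw [if_neg h, if_neg (fun h' => h ⟨h'.2, h'.1⟩), star_zero]

/-- Conjugating a placed block by `diag(d) ⊗ 1` rescales it: `D E_{xy}(A) D = E_{xy}((d_x d_y) A)`. [folklore] -/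
private theorem diagonal_mul_placed_mul_diagonal (d : ι → R) (x y : ι) (A : Matrix n n R) :
    diagonal (d ∘ Prod.fst : ι × n → R) * placed x y A * diagonal (d ∘ Prod.fst : ι × n → R)
      = placed x y ((d x * d y) • A) := by
  ext p q
  simp only [mul_diagonal, diagonal_mul, placed_apply, Matrix.smul_apply, smul_eq_mul, Function.comp_apply]
  by_cases h : x = p.1 ∧ y = q.1
  · obtain ⟨h1, h2⟩ := h
    simp [h1, h2]; ring
  · simp [h]

omit [DecidableEq n] in
/-- The vector `E_{xy}(A) v` has `x`-component `A v_y` and vanishes elsewhere. [folklore] -/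
private theorem placed_mulVec (x y : ι) (A : Matrix n n R) (v : ι × n → R) (p : ι × n) :
    (placed x y A *ᵥ v) p = if x = p.1 then (A *ᵥ fun j => v (y, j)) p.2 else 0 := by
  simp only [mulVec, dotProduct, placed_apply]
  rw [Fintype.sum_prod_type]
  by_cases hx : x = p.1
  · simp only [hx, true_and, if_true]
    rw [Finset.sum_eq_single y]
    · simp
    · intro y' _ hy'; simp [Ne.symm hy']
    · simp
  · simp [hx]

omit [DecidableEq n] in
/-- **The quadratic form of a placed block**: `⟨v, E_{xy}(A) v⟩ = ⟨v_x, A v_y⟩`. [folklore] -/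
private theorem star_dotProduct_placed_mulVec [StarRing R] (x y : ι) (A : Matrix n n R) (v : ι × n → R) :
    star v ⬝ᵥ (placed x y A *ᵥ v) = star (fun i => v (x, i)) ⬝ᵥ (A *ᵥ fun j => v (y, j)) := by
  simp only [dotProduct, Pi.star_apply, placed_mulVec]
  rw [Fintype.sum_prod_type]
  rw [Finset.sum_eq_single x]
  · simp
  · intro x' _ hx'; simp [Ne.symm hx']
  · simp

end Blocks

/-! ## §2. The sesquilinear domination `|⟨u, B v⟩| ≤ t‖u‖‖v‖` of an `n × n` block by a number -/

section Dom

variable {𝕜 : Type*} [RCLike 𝕜] {n : Type*} [Fintype n] [DecidableEq n]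

/-- The Euclidean norm of `u : n → 𝕜` (via `EuclideanSpace 𝕜 n`). [folklore] -/
noncomputable def l2 (u : n → 𝕜) : ℝ := ‖(WithLp.toLp 2 u : EuclideanSpace 𝕜 n)‖

omit [DecidableEq n] in
/-- `l2 u ≥ 0`. [folklore] -/
private theorem l2_nonneg (u : n → 𝕜) : 0 ≤ l2 u := norm_nonneg _

omit [DecidableEq n] in
/-- `star u ⬝ᵥ w` is the Euclidean inner product `⟪u, w⟫`. [folklore] -/
private theorem star_dotProduct_eq_inner (u w : n → 𝕜) :
    star u ⬝ᵥ w = ⟪(WithLp.toLp 2 u : EuclideanSpace 𝕜 n), WithLp.toLp 2 w⟫_𝕜 := by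
  rw [EuclideanSpace.inner_toLp_toLp, dotProduct_comm]

omit [DecidableEq n] in
/-- Cauchy–Schwarz: `|star u ⬝ᵥ w| ≤ ‖u‖‖w‖`. [folklore] -/
private theorem norm_star_dotProduct_le (u w : n → 𝕜) : ‖star u ⬝ᵥ w‖ ≤ l2 u * l2 w := by
  rw [star_dotProduct_eq_inner]
  exact norm_inner_le_norm _ _

omit [DecidableEq n] in
/-- `‖u‖² = Re (star u ⬝ᵥ u)`. [folklore] -/
private theorem l2_sq_eq (u : n → 𝕜) : l2 u ^ 2 = RCLike.re (star u ⬝ᵥ u) := by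
  rw [star_dotProduct_eq_inner, l2, norm_sq_eq_re_inner (𝕜 := 𝕜)]

omit [DecidableEq n] in
/-- `‖u‖² = Σ_i ‖u_i‖²`. [folklore] -/
private theorem l2_sq_eq_sum (u : n → 𝕜) : l2 u ^ 2 = ∑ i, ‖u i‖ ^ 2 := by
  rw [l2, EuclideanSpace.norm_eq, Real.sq_sqrt (Finset.sum_nonneg fun i _ => sq_nonneg _)]

/-- A unitary matrix preserves the Euclidean norm: `‖V w‖ = ‖w‖`. [folklore] -/
private theorem l2_unitary_mulVec {V : Matrix n n 𝕜} (hV : V ∈ Matrix.unitaryGroup n 𝕜) (w : n → 𝕜) :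
    l2 (V *ᵥ w) = l2 w := by
  have hVV : Vᴴ * V = 1 := by
    have := Matrix.mem_unitaryGroup_iff'.mp hV
    simpa only [star_eq_conjTranspose] using this
  have h1 : star (V *ᵥ w) ⬝ᵥ (V *ᵥ w) = star w ⬝ᵥ w := by
    rw [star_mulVec, dotProduct_mulVec, vecMul_vecMul, hVV, vecMul_one]
  have h2 : l2 (V *ᵥ w) ^ 2 = l2 w ^ 2 := by rw [l2_sq_eq, l2_sq_eq, h1]
  exact (sq_eq_sq₀ (l2_nonneg _) (l2_nonneg _)).mp h2

/-- `‖e_i‖ = 1`. [folklore] -/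
private theorem l2_single (i : n) : l2 (Pi.single i (1 : 𝕜)) = 1 := by
  rw [l2, PiLp.toLp_single, PiLp.norm_single, norm_one]

/-- A diagonal entry as a pairing with a basis vector: `B i i = star e_i ⬝ᵥ (B e_i)`. [folklore] -/
private theorem apply_self_eq_star_single_dotProduct (B : Matrix n n 𝕜) (i : n) :
    B i i = star (Pi.single i (1 : 𝕜)) ⬝ᵥ (B *ᵥ Pi.single i 1) := by
  rw [← Pi.single_star, star_one, single_one_dotProduct, mulVec_single_one, col_apply]

/-- `Dom B t`: the sesquilinear form of the block `B` is bounded by `t` — `|⟨u, Bv⟩| ≤ t‖u‖‖v‖`. [folklore] -/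
private def Dom (B : Matrix n n 𝕜) (t : ℝ) : Prop := ∀ u v : n → 𝕜, ‖star u ⬝ᵥ (B *ᵥ v)‖ ≤ t * (l2 u * l2 v)

/-- `Dom 1 1` (Cauchy–Schwarz). [folklore] -/
private theorem dom_one : Dom (1 : Matrix n n 𝕜) 1 := by
  intro u v
  rw [one_mulVec, one_mul]
  exact norm_star_dotProduct_le u v

omit [DecidableEq n] in
/-- `Dom 0 0`. [folklore] -/
private theorem dom_zero : Dom (0 : Matrix n n 𝕜) 0 := by
  intro u v
  simp

omit [DecidableEq n] in
/-- `Dom` is additive. [folklore] -/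
private theorem Dom.add {B B' : Matrix n n 𝕜} {t t' : ℝ} (h : Dom B t) (h' : Dom B' t') : Dom (B + B') (t + t') := by
  intro u v
  rw [add_mulVec, dotProduct_add, add_mul]
  exact (norm_add_le _ _).trans (add_le_add (h u v) (h' u v))

omit [DecidableEq n] in
/-- `Dom` over a finite sum. [folklore] -/
private theorem Dom.sum {α : Type*} (s : Finset α) {B : α → Matrix n n 𝕜} {t : α → ℝ} (h : ∀ a ∈ s, Dom (B a) (t a)) :
    Dom (∑ a ∈ s, B a) (∑ a ∈ s, t a) := by
  classical
  induction s using Finset.induction_on with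
  | empty => simpa using (dom_zero (n := n) (𝕜 := 𝕜))
  | insert a s ha ih =>
    rw [Finset.sum_insert ha, Finset.sum_insert ha]
    exact (h a (Finset.mem_insert_self a s)).add (ih fun b hb => h b (Finset.mem_insert_of_mem hb))

omit [DecidableEq n] in
/-- `Dom` under a non-negative real scalar. [folklore] -/
private theorem Dom.smul {B : Matrix n n 𝕜} {t : ℝ} (h : Dom B t) {s : ℝ} (hs : 0 ≤ s) :
    Dom ((s : 𝕜) • B) (s * t) := by
  intro u v
  rw [smul_mulVec, dotProduct_smul, smul_eq_mul, norm_mul, RCLike.norm_ofReal, abs_of_nonneg hs, mul_assoc]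
  exact mul_le_mul_of_nonneg_left (h u v) hs

omit [DecidableEq n] in
/-- `Dom` of an `if`. [folklore] -/
private theorem Dom.ite {B : Matrix n n 𝕜} {t : ℝ} (P : Prop) [Decidable P] (h : P → Dom B t) :
    Dom (if P then B else 0) (if P then t else 0) := by
  by_cases hP : P
  · simpa [hP] using h hP
  · simpa [hP] using (dom_zero (n := n) (𝕜 := 𝕜))

/-- `Dom` under right multiplication by a unitary. [folklore] -/
private theorem Dom.mul_unitary {B : Matrix n n 𝕜} {t : ℝ} (h : Dom B t) {V : Matrix n n 𝕜}
    (hV : V ∈ Matrix.unitaryGroup n 𝕜) : Dom (B * V) t := by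
  intro u v
  rw [← mulVec_mulVec]
  have := h u (V *ᵥ v)
  rwa [l2_unitary_mulVec hV] at this

/-- The diamagnetic bookkeeping at one block: `Dom B t ⇒ Re tr B ≤ |n|·t`. [folklore] -/
private theorem Dom.re_trace_le {B : Matrix n n 𝕜} {t : ℝ} (h : Dom B t) :
    RCLike.re (trace B) ≤ Fintype.card n * t := by
  rw [trace, map_sum]
  calc ∑ i, RCLike.re (B.diag i) ≤ ∑ _i : n, t := by
        refine Finset.sum_le_sum fun i _ => ?_
        rw [diag_apply, apply_self_eq_star_single_dotProduct B i]
        refine (RCLike.re_le_norm _).trans ?_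
        have := h (Pi.single i 1) (Pi.single i 1)
        rwa [l2_single, mul_one, mul_one] at this
    _ = Fintype.card n * t := by rw [Finset.sum_const, Finset.card_univ, nsmul_eq_mul]

variable {ι : Type*} [Fintype ι]

/-- The `x`-component `v_x : n → 𝕜` of `v : ι × n → 𝕜`. [folklore] -/
def comp (v : ι × n → 𝕜) (x : ι) : n → 𝕜 := fun i => v (x, i)

omit [RCLike 𝕜] [Fintype ι] [Fintype n] [DecidableEq n] in
/-- Entries of a component. [folklore] -/
@[simp] private theorem comp_apply (v : ι × n → 𝕜) (x : ι) (i : n) : comp v x i = v (x, i) := rfl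

omit [DecidableEq n] in
/-- `‖v‖² = Σ_x ‖v_x‖²`. [folklore] -/
private theorem l2_sq_eq_sum_comp (v : ι × n → 𝕜) : l2 v ^ 2 = ∑ x, l2 (comp v x) ^ 2 := by
  simp only [l2_sq_eq_sum, comp_apply]
  exact Fintype.sum_prod_type _

end Dom

/-! ## §3. Hopping data on a finite multigraph and the minimally coupled operator `M_U` -/

/-- A finite multigraph with bond weights and site weights: sites `ι`, bonds `β` with end points `src b`, `tgt b`,
hopping weights `w b` (meant `≥ 0`) and diagonal (mass / boundary) weights `c x`.  For the covariant lattice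
Laplacian `−Δ_U + m²` on `Ω` (Neumann: only bonds inside `Ω`): `w ≡ ε^{d−2}`, `c x = ε^{d−2}·#{b ∋ x} + ε^d m²`.
[cite: BrydgesFrohlichSeiler1979, diamagnetic inequality (lattice Gaussian form, as invoked in Balaban1982Higgs2 (3.38) p.591)] -/
structure Hopping (ι β : Type*) where
  /-- source of a bond -/
  src : β → ι
  /-- target of a bond -/
  tgt : β → ι
  /-- hopping weight of a bond -/
  w : β → ℝ
  /-- diagonal weight of a site -/
  c : ι → ℝ

namespace Hopping

variable {𝕜 : Type*} [RCLike 𝕜]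
variable {ι β n : Type*} [Fintype ι] [Fintype β] [Fintype n] [DecidableEq ι] [DecidableEq n]
variable (H : Hopping ι β)

/-- The total hopping weight at a site: `Σ_{b : src b = x} w_b + Σ_{b : tgt b = x} w_b` (a self-loop counts twice). [folklore] -/
def rowSum (x : ι) : ℝ := ∑ b, ((if H.src b = x then H.w b else 0) + (if H.tgt b = x then H.w b else 0))

/-- Strict diagonal dominance: non-negative hopping weights and `Σ_{b∋x} w_b < c_x` at every site
(for `−Δ_U + m²`: `m² > 0`).
[cite: BrydgesFrohlichSeiler1979, diamagnetic inequality (lattice Gaussian form, as invoked in Balaban1982Higgs2 (3.38) p.591)] -/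
structure StrictDom : Prop where
  w_nonneg : ∀ b, 0 ≤ H.w b
  dom : ∀ x, H.rowSum x < H.c x

omit [Fintype ι] [DecidableEq n] [Fintype n] in
/-- `Σ_{b∋x} w_b ≥ 0`.
[cite: BrydgesFrohlichSeiler1979, diamagnetic inequality (lattice Gaussian form, as invoked in Balaban1982Higgs2 (3.38) p.591)] -/
theorem rowSum_nonneg (hw : ∀ b, 0 ≤ H.w b) (x : ι) : 0 ≤ H.rowSum x :=
  Finset.sum_nonneg fun b _ => add_nonneg (by split_ifs <;> simp [hw b]) (by split_ifs <;> simp [hw b])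

omit [Fintype ι] [DecidableEq n] [Fintype n] in
/-- Under strict dominance the diagonal weights are positive.
[cite: BrydgesFrohlichSeiler1979, diamagnetic inequality (lattice Gaussian form, as invoked in Balaban1982Higgs2 (3.38) p.591)] -/
theorem StrictDom.c_pos (hH : H.StrictDom) (x : ι) : 0 < H.c x :=
  (H.rowSum_nonneg hH.w_nonneg x).trans_lt (hH.dom x)

/-- The hopping matrix `T_U = Σ_b w_b (E_{src b, tgt b}(U_b) + E_{tgt b, src b}(U_b^*))` of the link field `U`. [folklore] -/
def hop (U : β → Matrix n n 𝕜) : Matrix (ι × n) (ι × n) 𝕜 :=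
  ∑ b, (H.w b : 𝕜) • (placed (H.src b) (H.tgt b) (U b) + placed (H.tgt b) (H.src b) (U b)ᴴ)

/-- **The minimally coupled operator** `M_U = diag(c) ⊗ 1 − T_U`:
`⟨φ, M_U φ⟩ = Σ_x c_x|φ_x|² − Σ_b w_b(⟨φ_{src b}, U_b φ_{tgt b}⟩ + c.c.)`; for `c_x = Σ_{b∋x} w_b + m²` this is
`Σ_b w_b |U_b φ_{tgt b} − φ_{src b}|² + m² Σ_x |φ_x|² = ⟨φ, (−Δ_U + m²) φ⟩`. [folklore] -/
def coupling (U : β → Matrix n n 𝕜) : Matrix (ι × n) (ι × n) 𝕜 :=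
  diagonal (fun p => (H.c p.1 : 𝕜)) - H.hop U

/-- The free link field `U ≡ 1`. [folklore] -/
def free : β → Matrix n n 𝕜 := fun _ => 1

/-- The normalised hopping data: weights `s_b = w_b/√(c_{src b} c_{tgt b})`, diagonal `1`
(so that `M_U = D^{½}(1 − S_U)D^{½}` with `S_U` the hopping matrix of the normalised data). [folklore] -/
noncomputable def normalize : Hopping ι β where
  src := H.src
  tgt := H.tgt
  w := fun b => H.w b / Real.sqrt (H.c (H.src b) * H.c (H.tgt b))
  c := fun _ => 1

/-- The scalar weight matrix `t_{xy} = Σ_{b : x → y} w_b + Σ_{b : y → x} w_b` (the `n = 1`, `U = 1` hopping matrix). [folklore] -/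
def weightMatrix : Matrix ι ι ℝ :=
  of fun x y => ∑ b, ((if H.src b = x ∧ H.tgt b = y then H.w b else 0) + (if H.tgt b = x ∧ H.src b = y then H.w b else 0))

/-- `D^{½} = diag(√c) ⊗ 1`. [folklore] -/
noncomputable def sqrtDiag : Matrix (ι × n) (ι × n) 𝕜 := diagonal ((fun x : ι => (Real.sqrt (H.c x) : 𝕜)) ∘ Prod.fst)

omit [Fintype ι] [DecidableEq n] [Fintype n] [Fintype β] [DecidableEq ι] in
/-- The normalised data has the same bonds (sources). [folklore] -/
@[simp] private theorem normalize_src : H.normalize.src = H.src := rfl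
omit [Fintype ι] [DecidableEq n] [Fintype n] [Fintype β] [DecidableEq ι] in
/-- The normalised data has the same bonds (targets). [folklore] -/
@[simp] private theorem normalize_tgt : H.normalize.tgt = H.tgt := rfl
omit [Fintype ι] [DecidableEq n] [Fintype n] [Fintype β] [DecidableEq ι] in
/-- The normalised data has diagonal `1`. [folklore] -/
@[simp] private theorem normalize_c (x : ι) : H.normalize.c x = 1 := rfl
omit [Fintype ι] [DecidableEq n] [Fintype n] [Fintype β] [DecidableEq ι] in
/-- The normalised weights `s_b = w_b/√(c_{src b} c_{tgt b})`. [folklore] -/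
private theorem normalize_w (b : β) : H.normalize.w b = H.w b / Real.sqrt (H.c (H.src b) * H.c (H.tgt b)) := rfl

omit [Fintype ι] [Fintype β] [DecidableEq n] [Fintype n] [DecidableEq ι] in
/-- The normalised weights are non-negative. [folklore] -/
private theorem normalize_w_nonneg (hw : ∀ b, 0 ≤ H.w b) (b : β) : 0 ≤ H.normalize.w b :=
  div_nonneg (hw b) (Real.sqrt_nonneg _)

/-! ### §3.1 Block structure -/

omit [Fintype ι] [DecidableEq n] [Fintype n] in
/-- The `(x, y)` block of `T_U`: `Σ_b w_b ([b : x → y] U_b + [b : y → x] U_b^*)`. [folklore] -/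
private theorem blk_hop (U : β → Matrix n n 𝕜) (x y : ι) : blk (H.hop U) x y =
    ∑ b, (H.w b : 𝕜) • ((if H.src b = x ∧ H.tgt b = y then U b else 0)
                      + (if H.tgt b = x ∧ H.src b = y then (U b)ᴴ else 0)) := by
  rw [hop, blk_sum]
  refine Finset.sum_congr rfl fun b _ => ?_
  rw [blk_smul, blk_add, blk_placed, blk_placed]

omit [Fintype ι] [Fintype n] in
/-- The blocks of the free hopping matrix are multiples of the identity: `(T_1)_{xy} = t_{xy}·1`. [folklore] -/
private theorem blk_hop_free (x y : ι) :
    blk (H.hop (free : β → Matrix n n 𝕜)) x y = (H.weightMatrix x y : 𝕜) • (1 : Matrix n n 𝕜) := by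
  rw [blk_hop]
  simp only [free, weightMatrix, of_apply, conjTranspose_one]
  rw [RCLike.ofReal_sum (K := 𝕜), Finset.sum_smul]
  refine Finset.sum_congr rfl fun b _ => ?_
  rw [RCLike.ofReal_add]
  by_cases h1 : H.src b = x ∧ H.tgt b = y <;> by_cases h2 : H.tgt b = x ∧ H.src b = y <;>
    simp [h1, h2, add_smul, smul_add]

omit [Fintype ι] [Fintype n] [DecidableEq n] in
/-- `T_U` is Hermitian (no unitarity needed).
[cite: BrydgesFrohlichSeiler1979, diamagnetic inequality (lattice Gaussian form, as invoked in Balaban1982Higgs2 (3.38) p.591)] -/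
theorem isHermitian_hop (U : β → Matrix n n 𝕜) : (H.hop U).IsHermitian := by
  unfold hop IsHermitian
  rw [conjTranspose_sum]
  refine Finset.sum_congr rfl fun b _ => ?_
  rw [conjTranspose_smul, conjTranspose_add, conjTranspose_placed, conjTranspose_placed, conjTranspose_conjTranspose,
    RCLike.star_def, RCLike.conj_ofReal, add_comm]

omit [Fintype ι] [Fintype n] in
/-- `M_U` is Hermitian.
[cite: BrydgesFrohlichSeiler1979, diamagnetic inequality (lattice Gaussian form, as invoked in Balaban1982Higgs2 (3.38) p.591)] -/
theorem isHermitian_coupling (U : β → Matrix n n 𝕜) : (H.coupling U).IsHermitian := by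
  unfold coupling
  refine IsHermitian.sub ?_ (H.isHermitian_hop U)
  refine isHermitian_diagonal_of_self_adjoint _ (funext fun p => ?_)
  simp [RCLike.star_def, RCLike.conj_ofReal]

/-! ### §3.2 The quadratic form of `T_U`, bond by bond -/

omit [DecidableEq n] in
/-- **The quadratic form of the hopping matrix, bond by bond**:
`⟨v, T_U v⟩ = Σ_b w_b (⟨v_{src b}, U_b v_{tgt b}⟩ + ⟨v_{tgt b}, U_b^* v_{src b}⟩)`.
[cite: BrydgesFrohlichSeiler1979, diamagnetic inequality (lattice Gaussian form, as invoked in Balaban1982Higgs2 (3.38) p.591)] -/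
theorem quadForm_hop (U : β → Matrix n n 𝕜) (v : ι × n → 𝕜) :
    star v ⬝ᵥ (H.hop U *ᵥ v) = ∑ b, (H.w b : 𝕜) *
      (star (comp v (H.src b)) ⬝ᵥ (U b *ᵥ comp v (H.tgt b)) +
        star (comp v (H.tgt b)) ⬝ᵥ ((U b)ᴴ *ᵥ comp v (H.src b))) := by
  unfold hop
  rw [Matrix.sum_mulVec, dotProduct_sum]
  refine Finset.sum_congr rfl fun b _ => ?_
  rw [smul_mulVec, dotProduct_smul, add_mulVec, dotProduct_add, star_dotProduct_placed_mulVec,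
    star_dotProduct_placed_mulVec, smul_eq_mul]
  rfl

/-- **The quadratic form of the minimally coupled operator, bond by bond**:
`⟨v, M_U v⟩ = Σ_x c_x ‖v_x‖² − Σ_b w_b (⟨v_{src b}, U_b v_{tgt b}⟩ + ⟨v_{tgt b}, U_b^* v_{src b}⟩)`.
[cite: BrydgesFrohlichSeiler1979, diamagnetic inequality (lattice Gaussian form, as invoked in Balaban1982Higgs2 (3.38) p.591)] -/
theorem quadForm_coupling (U : β → Matrix n n 𝕜) (v : ι × n → 𝕜) :
    star v ⬝ᵥ (H.coupling U *ᵥ v) = (∑ x, (H.c x : 𝕜) * (star (comp v x) ⬝ᵥ comp v x)) - ∑ b, (H.w b : 𝕜) *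
      (star (comp v (H.src b)) ⬝ᵥ (U b *ᵥ comp v (H.tgt b)) +
        star (comp v (H.tgt b)) ⬝ᵥ ((U b)ᴴ *ᵥ comp v (H.src b))) := by
  rw [coupling, sub_mulVec, dotProduct_sub, quadForm_hop]
  congr 1
  simp only [dotProduct, mulVec_diagonal, Pi.star_apply, comp_apply, Finset.mul_sum]
  rw [Fintype.sum_prod_type]
  refine Finset.sum_congr rfl fun x _ => Finset.sum_congr rfl fun i _ => ?_
  ring

omit [Fintype ι] [DecidableEq ι] in
/-- Cauchy–Schwarz on one bond: `|⟨a, U b⟩ + ⟨b, U^* a⟩| ≤ 2‖a‖‖b‖` for a unitary `U`. [folklore] -/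
private theorem norm_bond_term_le {V : Matrix n n 𝕜} (hV : V ∈ Matrix.unitaryGroup n 𝕜) (a b : n → 𝕜) :
    ‖star a ⬝ᵥ (V *ᵥ b) + star b ⬝ᵥ (Vᴴ *ᵥ a)‖ ≤ 2 * (l2 a * l2 b) := by
  have hV' : Vᴴ ∈ Matrix.unitaryGroup n 𝕜 := by
    simpa only [star_eq_conjTranspose] using Unitary.star_mem hV
  refine (norm_add_le _ _).trans ?_
  have h1 := norm_star_dotProduct_le a (V *ᵥ b)
  have h2 := norm_star_dotProduct_le b (Vᴴ *ᵥ a)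
  rw [l2_unitary_mulVec hV] at h1
  rw [l2_unitary_mulVec hV'] at h2
  linarith [mul_comm (l2 a) (l2 b)]

omit [Fintype ι] [Fintype β] [DecidableEq ι] [DecidableEq n] [Fintype n] in
/-- AM–GM on one bond: `2·(w/√(c_s c_t))·A·B ≤ w·(A²/c_s + B²/c_t)`. [folklore] -/
private theorem two_mul_normalized_le {w cs ct A B : ℝ} (hw : 0 ≤ w) (hcs : 0 < cs) (hct : 0 < ct) :
    w / Real.sqrt (cs * ct) * (2 * (A * B)) ≤ w * (A ^ 2 / cs + B ^ 2 / ct) := by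
  have hs : Real.sqrt (cs * ct) = Real.sqrt cs * Real.sqrt ct := Real.sqrt_mul hcs.le ct
  have hcs' : 0 < Real.sqrt cs := Real.sqrt_pos.2 hcs
  have hct' : 0 < Real.sqrt ct := Real.sqrt_pos.2 hct
  -- `2XY ≤ X² + Y²` with `X = A/√cs`, `Y = B/√ct`
  have key : 2 * (A * B) / (Real.sqrt cs * Real.sqrt ct) ≤ A ^ 2 / cs + B ^ 2 / ct := by
    have hX : (A / Real.sqrt cs) ^ 2 = A ^ 2 / cs := by
      rw [div_pow, Real.sq_sqrt hcs.le]
    have hY : (B / Real.sqrt ct) ^ 2 = B ^ 2 / ct := by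
      rw [div_pow, Real.sq_sqrt hct.le]
    have h2 : 2 * (A * B) / (Real.sqrt cs * Real.sqrt ct) = 2 * (A / Real.sqrt cs) * (B / Real.sqrt ct) := by
      field_simp
    rw [h2, ← hX, ← hY]
    nlinarith [sq_nonneg (A / Real.sqrt cs - B / Real.sqrt ct)]
  calc w / Real.sqrt (cs * ct) * (2 * (A * B)) = w * (2 * (A * B) / (Real.sqrt cs * Real.sqrt ct)) := by
        rw [hs]; ring
    _ ≤ w * (A ^ 2 / cs + B ^ 2 / ct) := mul_le_mul_of_nonneg_left key hw

omit [DecidableEq n] [Fintype n] in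
/-- Resummation site by site: `Σ_b w_b (a_{src b}/c_{src b} + a_{tgt b}/c_{tgt b}) = Σ_x (Σ_{b∋x} w_b) a_x / c_x`. [folklore] -/
private theorem sum_bond_eq_sum_site (a : ι → ℝ) :
    ∑ b, H.w b * (a (H.src b) / H.c (H.src b) + a (H.tgt b) / H.c (H.tgt b)) = ∑ x, H.rowSum x * (a x / H.c x) := by
  classical
  simp only [rowSum, Finset.sum_mul]
  rw [Finset.sum_comm]
  refine Finset.sum_congr rfl fun b _ => ?_
  simp only [add_mul, ite_mul, zero_mul, Finset.sum_add_distrib, Finset.sum_ite_eq, Finset.mem_univ, if_true]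
  ring

/-- **The key quadratic-form bound for the normalised hopping matrix**:
`|⟨v, S_U v⟩| ≤ Σ_x (Σ_{b∋x} w_b / c_x) ‖v_x‖²`.
[cite: BrydgesFrohlichSeiler1979, diamagnetic inequality (lattice Gaussian form, as invoked in Balaban1982Higgs2 (3.38) p.591)] -/
theorem norm_quadForm_hop_normalize_le (hH : H.StrictDom) {U : β → Matrix n n 𝕜}
    (hU : ∀ b, U b ∈ Matrix.unitaryGroup n 𝕜) (v : ι × n → 𝕜) :
    ‖star v ⬝ᵥ (H.normalize.hop U *ᵥ v)‖ ≤ ∑ x, H.rowSum x * (l2 (comp v x) ^ 2 / H.c x) := by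
  classical
  rw [quadForm_hop]
  refine (norm_sum_le _ _).trans ?_
  rw [← H.sum_bond_eq_sum_site (fun x => l2 (comp v x) ^ 2)]
  refine Finset.sum_le_sum fun b _ => ?_
  rw [norm_mul, RCLike.norm_ofReal, abs_of_nonneg (H.normalize_w_nonneg hH.w_nonneg b), normalize_w,
    normalize_src, normalize_tgt]
  refine (mul_le_mul_of_nonneg_left (norm_bond_term_le (hU b) _ _)
    (div_nonneg (hH.w_nonneg b) (Real.sqrt_nonneg _))).trans ?_
  exact two_mul_normalized_le (hH.w_nonneg b) (hH.c_pos H _) (hH.c_pos H _)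

omit [DecidableEq n] in
/-- Strictness: `Σ_x (Σ_{b∋x} w_b / c_x) ‖v_x‖² < ‖v‖²` for `v ≠ 0`. [folklore] -/
private theorem sum_rowSum_mul_lt (hH : H.StrictDom) {v : ι × n → 𝕜} (hv : v ≠ 0) :
    ∑ x, H.rowSum x * (l2 (comp v x) ^ 2 / H.c x) < l2 v ^ 2 := by
  rw [l2_sq_eq_sum_comp]
  -- some component is nonzero
  obtain ⟨⟨x₀, i₀⟩, hx₀⟩ : ∃ p, v p ≠ 0 := by
    by_contra h
    exact hv (funext fun p => not_not.mp (not_exists.mp h p))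
  have hpos : 0 < l2 (comp v x₀) ^ 2 := by
    rw [l2_sq_eq_sum]
    exact Finset.sum_pos' (fun i _ => sq_nonneg _) ⟨i₀, Finset.mem_univ _, by positivity⟩
  have hle : ∀ x, H.rowSum x * (l2 (comp v x) ^ 2 / H.c x) ≤ l2 (comp v x) ^ 2 := fun x => by
    rw [mul_div_assoc', div_le_iff₀ (hH.c_pos H x), mul_comm (l2 (comp v x) ^ 2)]
    exact mul_le_mul_of_nonneg_right (hH.dom x).le (sq_nonneg _)
  have hlt : H.rowSum x₀ * (l2 (comp v x₀) ^ 2 / H.c x₀) < l2 (comp v x₀) ^ 2 := by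
    rw [mul_div_assoc', div_lt_iff₀ (hH.c_pos H x₀), mul_comm (l2 (comp v x₀) ^ 2)]
    exact mul_lt_mul_of_pos_right (hH.dom x₀) hpos
  exact Finset.sum_lt_sum (fun x _ => hle x) ⟨x₀, Finset.mem_univ _, hlt⟩

/-- `|⟨v, S_U v⟩| < ‖v‖²` for `v ≠ 0`.
[cite: BrydgesFrohlichSeiler1979, diamagnetic inequality (lattice Gaussian form, as invoked in Balaban1982Higgs2 (3.38) p.591)] -/
theorem norm_quadForm_hop_normalize_lt (hH : H.StrictDom) {U : β → Matrix n n 𝕜}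
    (hU : ∀ b, U b ∈ Matrix.unitaryGroup n 𝕜) {v : ι × n → 𝕜} (hv : v ≠ 0) :
    ‖star v ⬝ᵥ (H.normalize.hop U *ᵥ v)‖ < l2 v ^ 2 :=
  (H.norm_quadForm_hop_normalize_le hH hU v).trans_lt (H.sum_rowSum_mul_lt hH hv)

/-! ### §3.3 `M_U = D^{½}(1 − S_U)D^{½}` and positivity -/

/-- `√a · (w/√(ab)) · √b = w`. [folklore] -/
private theorem sqrt_mul_div_sqrt_mul_sqrt {a b : ℝ} (ha : 0 < a) (hb : 0 < b) (w : ℝ) :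
    Real.sqrt a * Real.sqrt b * (w / Real.sqrt (a * b)) = w := by
  rw [Real.sqrt_mul ha.le, mul_div_assoc']
  have : Real.sqrt a * Real.sqrt b ≠ 0 := mul_ne_zero (Real.sqrt_pos.2 ha).ne' (Real.sqrt_pos.2 hb).ne'
  field_simp

/-- **`M_U = D^{½}(1 − S_U)D^{½}`**.
[cite: BrydgesFrohlichSeiler1979, diamagnetic inequality (lattice Gaussian form, as invoked in Balaban1982Higgs2 (3.38) p.591)] -/
theorem coupling_eq_conj (hc : ∀ x, 0 < H.c x) (U : β → Matrix n n 𝕜) :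
    H.coupling U = H.sqrtDiag * (1 - H.normalize.hop U) * H.sqrtDiag := by
  have hD : (H.sqrtDiag (𝕜 := 𝕜) (n := n)) * H.sqrtDiag (𝕜 := 𝕜) (n := n) = diagonal fun p => (H.c p.1 : 𝕜) := by
    rw [sqrtDiag, diagonal_mul_diagonal]
    congr 1
    funext p
    rw [Function.comp_apply, ← RCLike.ofReal_mul, Real.mul_self_sqrt (hc p.1).le]
  rw [mul_sub, sub_mul, mul_one, hD, coupling]
  congr 1
  -- the hopping part
  rw [hop, hop, Finset.mul_sum, Finset.sum_mul]
  refine Finset.sum_congr rfl fun b _ => ?_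
  rw [Matrix.mul_smul, Matrix.smul_mul, mul_add, add_mul, sqrtDiag,
    diagonal_mul_placed_mul_diagonal, diagonal_mul_placed_mul_diagonal, placed_smul, placed_smul,
    normalize_src, normalize_tgt, normalize_w,
    mul_comm ((Real.sqrt (H.c (H.tgt b)) : 𝕜)) ((Real.sqrt (H.c (H.src b)) : 𝕜)), ← smul_add, smul_smul]
  congr 1
  rw [← RCLike.ofReal_mul, ← RCLike.ofReal_mul]
  congr 1
  rw [mul_comm]
  exact (sqrt_mul_div_sqrt_mul_sqrt (hc _) (hc _) _).symm

omit [Fintype β] in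
/-- `det D^{½}² = Π_{(x,i)} c_x`. [folklore] -/
private theorem det_sqrtDiag_mul_self (hc : ∀ x, 0 < H.c x) :
    det (H.sqrtDiag (𝕜 := 𝕜) (n := n)) * det (H.sqrtDiag (𝕜 := 𝕜) (n := n)) = ∏ p : ι × n, (H.c p.1 : 𝕜) := by
  rw [← det_mul, sqrtDiag, diagonal_mul_diagonal, det_diagonal]
  refine Finset.prod_congr rfl fun p _ => ?_
  rw [Function.comp_apply, ← RCLike.ofReal_mul, Real.mul_self_sqrt (hc p.1).le]

/-- **`det M_U = (Π_{(x,i)} c_x) · det(1 − S_U)`**.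
[cite: BrydgesFrohlichSeiler1979, diamagnetic inequality (lattice Gaussian form, as invoked in Balaban1982Higgs2 (3.38) p.591)] -/
theorem det_coupling_eq (hc : ∀ x, 0 < H.c x) (U : β → Matrix n n 𝕜) :
    det (H.coupling U) = (∏ p : ι × n, (H.c p.1 : 𝕜)) * det (1 - H.normalize.hop U) := by
  rw [H.coupling_eq_conj hc, det_mul, det_mul, ← H.det_sqrtDiag_mul_self hc]
  ring

/-- `1 − S_U` is positive definite under strict dominance.
[cite: BrydgesFrohlichSeiler1979, diamagnetic inequality (lattice Gaussian form, as invoked in Balaban1982Higgs2 (3.38) p.591)] -/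
theorem posDef_one_sub_hop_normalize (hH : H.StrictDom) {U : β → Matrix n n 𝕜}
    (hU : ∀ b, U b ∈ Matrix.unitaryGroup n 𝕜) : (1 - H.normalize.hop U).PosDef := by
  have hherm : (1 - H.normalize.hop U).IsHermitian := isHermitian_one.sub (H.normalize.isHermitian_hop U)
  refine PosDef.of_dotProduct_mulVec_pos hherm fun v hv => ?_
  have him : RCLike.im (star v ⬝ᵥ ((1 - H.normalize.hop U) *ᵥ v)) = 0 := hherm.im_star_dotProduct_mulVec_self v
  have hre : 0 < RCLike.re (star v ⬝ᵥ ((1 - H.normalize.hop U) *ᵥ v)) := by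
    rw [sub_mulVec, dotProduct_sub, one_mulVec, map_sub, ← l2_sq_eq v]
    have hlt := H.norm_quadForm_hop_normalize_lt hH hU hv
    have := RCLike.re_le_norm (star v ⬝ᵥ (H.normalize.hop U *ᵥ v))
    linarith
  exact RCLike.pos_iff.mpr ⟨hre, him⟩

/-- **`M_U` is positive definite** under strict dominance (`m² > 0`).
[cite: BrydgesFrohlichSeiler1979, diamagnetic inequality (lattice Gaussian form, as invoked in Balaban1982Higgs2 (3.38) p.591)] -/
theorem posDef_coupling (hH : H.StrictDom) {U : β → Matrix n n 𝕜} (hU : ∀ b, U b ∈ Matrix.unitaryGroup n 𝕜) :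
    (H.coupling U).PosDef := by
  rw [H.coupling_eq_conj (hH.c_pos H) U]
  have hD : (H.sqrtDiag (𝕜 := 𝕜) (n := n))ᴴ = H.sqrtDiag := by
    rw [sqrtDiag, diagonal_conjTranspose]
    congr 1
    funext p
    simp [RCLike.star_def, RCLike.conj_ofReal]
  have hinj : Function.Injective (H.sqrtDiag (𝕜 := 𝕜) (n := n)).mulVec := by
    rw [Matrix.mulVec_injective_iff_isUnit, Matrix.isUnit_iff_isUnit_det, sqrtDiag, det_diagonal, isUnit_iff_ne_zero]
    refine Finset.prod_ne_zero_iff.mpr fun p _ => ?_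
    rw [Function.comp_apply, Ne, RCLike.ofReal_eq_zero]
    exact (Real.sqrt_pos.2 (hH.c_pos H p.1)).ne'
  have := (H.posDef_one_sub_hop_normalize hH hU).conjTranspose_mul_mul_same hinj
  rwa [hD] at this

/-! ### §3.4 The walk expansion: blocks of `T_U^k` are dominated by the scalar weight walks -/

section Walks

variable (K : Hopping ι β)

omit [Fintype ι] [DecidableEq n] [Fintype n] in
/-- Entries of the scalar weight matrix. [folklore] -/
private theorem weightMatrix_apply (x y : ι) : K.weightMatrix x y =
    ∑ b, ((if K.src b = x ∧ K.tgt b = y then K.w b else 0) + (if K.tgt b = x ∧ K.src b = y then K.w b else 0)) := rfl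

/-- **The diamagnetic step, blockwise**: the `(x, y)` block of `T_U^k` is dominated, as a sesquilinear form, by the
`(x, y)` entry of the `k`-th power of the scalar weight matrix (sum over walks of products of weights; each walk
carries a product of `k` unitaries, of norm `1`). [folklore] -/
private theorem dom_blk_pow (hw : ∀ b, 0 ≤ K.w b) {U : β → Matrix n n 𝕜} (hU : ∀ b, U b ∈ Matrix.unitaryGroup n 𝕜) :
    ∀ (k : ℕ) (x y : ι), Dom (blk ((K.hop U) ^ k) x y) ((K.weightMatrix ^ k) x y) := by
  intro k
  induction k with
  | zero =>
    intro x y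
    rw [pow_zero, pow_zero, blk_one, one_apply]
    by_cases h : x = y
    · rw [if_pos h, if_pos h]; exact dom_one
    · rw [if_neg h, if_neg h]; exact dom_zero
  | succ k ih =>
    intro x y
    rw [pow_succ, pow_succ, blk_mul, mul_apply]
    refine Dom.sum _ fun z _ => ?_
    rw [blk_hop, Finset.mul_sum, weightMatrix_apply, Finset.mul_sum]
    refine Dom.sum _ fun b _ => ?_
    rw [Matrix.mul_smul, mul_add, mul_ite, mul_ite]
    simp only [mul_zero]
    have e : (K.weightMatrix ^ k) x z *
        ((if K.src b = z ∧ K.tgt b = y then K.w b else 0) + (if K.tgt b = z ∧ K.src b = y then K.w b else 0))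
        = K.w b * ((if K.src b = z ∧ K.tgt b = y then (K.weightMatrix ^ k) x z else 0)
          + (if K.tgt b = z ∧ K.src b = y then (K.weightMatrix ^ k) x z else 0)) := by
      split_ifs <;> ring
    rw [e]
    have hU' : (U b)ᴴ ∈ Matrix.unitaryGroup n 𝕜 := by
      simpa only [star_eq_conjTranspose] using Unitary.star_mem (hU b)
    exact (Dom.add (Dom.ite _ fun _ => (ih x z).mul_unitary (hU b))
      (Dom.ite _ fun _ => (ih x z).mul_unitary hU')).smul (hw b)

/-- **`Re Tr(T_U^k) ≤ |n| · Tr(t^k)`**.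
[cite: BrydgesFrohlichSeiler1979, diamagnetic inequality (lattice Gaussian form, as invoked in Balaban1982Higgs2 (3.38) p.591)] -/
theorem re_trace_pow_hop_le (hw : ∀ b, 0 ≤ K.w b) {U : β → Matrix n n 𝕜} (hU : ∀ b, U b ∈ Matrix.unitaryGroup n 𝕜)
    (k : ℕ) : RCLike.re (trace ((K.hop U) ^ k)) ≤ Fintype.card n * trace (K.weightMatrix ^ k) := by
  rw [trace_eq_sum_trace_blk, map_sum, trace, Finset.mul_sum]
  exact Finset.sum_le_sum fun x _ => (K.dom_blk_pow hw hU k x x).re_trace_le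

/-- The blocks of `T_1^k` are `(t^k)_{xy} · 1`. [folklore] -/
private theorem blk_pow_free (k : ℕ) (x y : ι) :
    blk ((K.hop (free : β → Matrix n n 𝕜)) ^ k) x y = ((K.weightMatrix ^ k) x y : 𝕜) • (1 : Matrix n n 𝕜) := by
  induction k generalizing x y with
  | zero =>
    rw [pow_zero, pow_zero, blk_one, one_apply]
    split_ifs <;> simp
  | succ k ih =>
    rw [pow_succ, pow_succ, blk_mul, mul_apply, RCLike.ofReal_sum, Finset.sum_smul]
    refine Finset.sum_congr rfl fun z _ => ?_
    rw [ih, blk_hop_free, smul_mul_assoc, one_mul, smul_smul, ← RCLike.ofReal_mul]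

/-- **`Tr(T_1^k) = |n| · Tr(t^k)`**.
[cite: BrydgesFrohlichSeiler1979, diamagnetic inequality (lattice Gaussian form, as invoked in Balaban1982Higgs2 (3.38) p.591)] -/
theorem re_trace_pow_free (k : ℕ) :
    RCLike.re (trace ((K.hop (free : β → Matrix n n 𝕜)) ^ k)) = Fintype.card n * trace (K.weightMatrix ^ k) := by
  rw [trace_eq_sum_trace_blk, map_sum, trace, Finset.mul_sum]
  refine Finset.sum_congr rfl fun x _ => ?_
  rw [blk_pow_free, trace_smul, trace_one, diag_apply, smul_eq_mul, ← RCLike.ofReal_natCast, ← RCLike.ofReal_mul,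
    RCLike.ofReal_re, mul_comm]

/-- **THE DIAMAGNETIC STEP**: `Re Tr(T_U^k) ≤ Re Tr(T_1^k)` for every `k`.
[cite: BrydgesFrohlichSeiler1979, diamagnetic inequality (lattice Gaussian form, as invoked in Balaban1982Higgs2 (3.38) p.591)] -/
theorem re_trace_pow_le_free (hw : ∀ b, 0 ≤ K.w b) {U : β → Matrix n n 𝕜} (hU : ∀ b, U b ∈ Matrix.unitaryGroup n 𝕜)
    (k : ℕ) : RCLike.re (trace ((K.hop U) ^ k)) ≤ RCLike.re (trace ((K.hop (free : β → Matrix n n 𝕜)) ^ k)) := by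
  rw [re_trace_pow_free]
  exact K.re_trace_pow_hop_le hw hU k

end Walks

end Hopping

/-! ## §4. Spectral facts for a Hermitian matrix with spectrum in `(−1, 1)` -/

section Spectral

variable {𝕜 : Type*} [RCLike 𝕜] {m : Type*} [Fintype m] [DecidableEq m]

/-- Conjugation by a unitary preserves the trace. [folklore] -/
private theorem trace_conjStarAlgAut (V : unitary (Matrix m m 𝕜)) (X : Matrix m m 𝕜) :
    trace (Unitary.conjStarAlgAut 𝕜 (Matrix m m 𝕜) V X) = trace X := by
  rw [Unitary.conjStarAlgAut_apply, trace_mul_cycle, Unitary.coe_star_mul_self, one_mul]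

/-- Conjugation by a unitary preserves the determinant. [folklore] -/
private theorem det_conjStarAlgAut (V : unitary (Matrix m m 𝕜)) (X : Matrix m m 𝕜) :
    det (Unitary.conjStarAlgAut 𝕜 (Matrix m m 𝕜) V X) = det X := by
  rw [Unitary.conjStarAlgAut_apply, det_mul, det_mul, mul_right_comm, ← det_mul, Unitary.mul_star_self_of_mem V.prop,
    det_one, one_mul]

/-- `Tr(S^k) = Σ_i λ_i^k`. [folklore] -/
private theorem trace_pow_eq_sum {S : Matrix m m 𝕜} (hS : S.IsHermitian) (k : ℕ) :
    trace (S ^ k) = ∑ i, ((hS.eigenvalues i : 𝕜)) ^ k := by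
  have h := hS.spectral_theorem
  conv_lhs => rw [h]
  rw [← map_pow, trace_conjStarAlgAut, diagonal_pow, trace_diagonal]
  rfl

/-- `Re Tr(S^k) = Σ_i λ_i^k`. [folklore] -/
private theorem re_trace_pow_eq_sum {S : Matrix m m 𝕜} (hS : S.IsHermitian) (k : ℕ) :
    RCLike.re (trace (S ^ k)) = ∑ i, (hS.eigenvalues i) ^ k := by
  rw [trace_pow_eq_sum hS k, map_sum]
  refine Finset.sum_congr rfl fun i _ => ?_
  rw [← RCLike.ofReal_pow, RCLike.ofReal_re]

/-- `det(1 − S) = Π_i (1 − λ_i)`. [folklore] -/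
private theorem det_one_sub_eq_prod {S : Matrix m m 𝕜} (hS : S.IsHermitian) :
    det (1 - S) = ∏ i, (1 - (hS.eigenvalues i : 𝕜)) := by
  have h := hS.spectral_theorem
  conv_lhs => rw [h]
  rw [← map_one (Unitary.conjStarAlgAut 𝕜 (Matrix m m 𝕜) hS.eigenvectorUnitary), ← map_sub, det_conjStarAlgAut,
    ← diagonal_one, diagonal_sub, det_diagonal]
  rfl

/-- `det(1 − S)` is the real number `Π_i (1 − λ_i)`. [folklore] -/
private theorem det_one_sub_eq_ofReal_prod {S : Matrix m m 𝕜} (hS : S.IsHermitian) :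
    det (1 - S) = ((∏ i, (1 - hS.eigenvalues i) : ℝ) : 𝕜) := by
  rw [det_one_sub_eq_prod hS, RCLike.ofReal_prod]
  refine Finset.prod_congr rfl fun i _ => ?_
  rw [RCLike.ofReal_sub, RCLike.ofReal_one]

/-- If `|⟨v, S v⟩| < ‖v‖²` for all `v ≠ 0`, every eigenvalue of `S` has modulus `< 1`. [folklore] -/
private theorem abs_eigenvalues_lt_one_of_quadForm {S : Matrix m m 𝕜} (hS : S.IsHermitian)
    (h : ∀ v : m → 𝕜, v ≠ 0 → ‖star v ⬝ᵥ (S *ᵥ v)‖ < l2 v ^ 2) (i : m) :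
    |hS.eigenvalues i| < 1 := by
  rw [hS.eigenvalues_eq i]
  have hb1 : ‖hS.eigenvectorBasis i‖ = 1 := hS.eigenvectorBasis.orthonormal.1 i
  have hb : l2 (WithLp.ofLp (hS.eigenvectorBasis i) : m → 𝕜) = 1 := by
    rw [l2, WithLp.toLp_ofLp, hb1]
  have hne : (WithLp.ofLp (hS.eigenvectorBasis i) : m → 𝕜) ≠ 0 := by
    intro h0
    have : l2 (WithLp.ofLp (hS.eigenvectorBasis i) : m → 𝕜) = 0 := by
      rw [h0, l2, WithLp.toLp_zero, norm_zero]
    rw [hb] at this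
    exact one_ne_zero this
  have := h _ hne
  rw [hb, one_pow] at this
  exact (RCLike.abs_re_le_norm _).trans_lt this

omit [DecidableEq m] in
/-- The logarithmic series, summed over the spectrum: `−log Π_i(1 − λ_i) = Σ_{k≥1} (Σ_i λ_i^k)/k` when all
`|λ_i| < 1`. [folklore] -/
private theorem hasSum_neg_log_prod_one_sub {lam : m → ℝ} (hlam : ∀ i, |lam i| < 1) :
    HasSum (fun k : ℕ => (∑ i, lam i ^ (k + 1)) / (k + 1)) (-Real.log (∏ i, (1 - lam i))) := by
  have h : ∀ i ∈ (Finset.univ : Finset m),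
      HasSum (fun k : ℕ => lam i ^ (k + 1) / (k + 1)) (-Real.log (1 - lam i)) :=
    fun i _ => Real.hasSum_pow_div_log_of_abs_lt_one (hlam i)
  have hsum := hasSum_sum h
  have hne : ∀ i ∈ (Finset.univ : Finset m), (1 - lam i) ≠ 0 := fun i _ => by
    have := hlam i
    rw [abs_lt] at this
    linarith
  rw [Real.log_prod hne, ← Finset.sum_neg_distrib]
  refine hsum.congr_fun fun k => ?_
  rw [Finset.sum_div]

omit [DecidableEq m] in
/-- Positivity: `0 < Π_i (1 − λ_i)` when all `|λ_i| < 1`. [folklore] -/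
private theorem prod_one_sub_pos {lam : m → ℝ} (hlam : ∀ i, |lam i| < 1) : 0 < ∏ i, (1 - lam i) :=
  Finset.prod_pos fun i _ => by
    have := hlam i
    rw [abs_lt] at this
    linarith

end Spectral

/-! ## §5. Assembly: the diamagnetic inequality -/

namespace Hopping

variable {𝕜 : Type*} [RCLike 𝕜]
variable {ι β n : Type*} [Fintype ι] [Fintype β] [Fintype n] [DecidableEq ι] [DecidableEq n]
variable (H : Hopping ι β)

/-- All eigenvalues of `S_U` have modulus `< 1` (strict dominance).
[cite: BrydgesFrohlichSeiler1979, diamagnetic inequality (lattice Gaussian form, as invoked in Balaban1982Higgs2 (3.38) p.591)] -/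
theorem abs_eigenvalues_lt_one (hH : H.StrictDom) {U : β → Matrix n n 𝕜} (hU : ∀ b, U b ∈ Matrix.unitaryGroup n 𝕜)
    (i : ι × n) : |(H.normalize.isHermitian_hop U).eigenvalues i| < 1 :=
  abs_eigenvalues_lt_one_of_quadForm _ (fun _ hv => H.norm_quadForm_hop_normalize_lt hH hU hv) i

/-- `det(1 − S_U) = Π_i (1 − λ_i(U))` as a real number.
[cite: BrydgesFrohlichSeiler1979, diamagnetic inequality (lattice Gaussian form, as invoked in Balaban1982Higgs2 (3.38) p.591)] -/
theorem det_one_sub_hop_normalize (U : β → Matrix n n 𝕜) :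
    det (1 - H.normalize.hop U) =
      ((∏ i, (1 - (H.normalize.isHermitian_hop U).eigenvalues i) : ℝ) : 𝕜) :=
  det_one_sub_eq_ofReal_prod _

/-- **The diamagnetic inequality for the normalised operators**:
`det(1 − S_1) ≤ det(1 − S_U)` (as real numbers `Π_i (1 − λ_i)`).
[cite: BrydgesFrohlichSeiler1979, diamagnetic inequality (lattice Gaussian form, as invoked in Balaban1982Higgs2 (3.38) p.591)] -/
theorem prod_one_sub_eigenvalues_free_le (hH : H.StrictDom) {U : β → Matrix n n 𝕜}
    (hU : ∀ b, U b ∈ Matrix.unitaryGroup n 𝕜) :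
    ∏ i, (1 - (H.normalize.isHermitian_hop (free : β → Matrix n n 𝕜)).eigenvalues i)
      ≤ ∏ i, (1 - (H.normalize.isHermitian_hop U).eigenvalues i) := by
  have hfree : ∀ b, (free : β → Matrix n n 𝕜) b ∈ Matrix.unitaryGroup n 𝕜 := fun _ => Submonoid.one_mem _
  have hU1 := H.abs_eigenvalues_lt_one hH hU
  have hF1 := H.abs_eigenvalues_lt_one hH hfree
  have hposU := prod_one_sub_pos hU1
  have hposF := prod_one_sub_pos hF1
  -- compare the logarithmic series term by term
  have hsU := hasSum_neg_log_prod_one_sub hU1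
  have hsF := hasSum_neg_log_prod_one_sub hF1
  have hw : ∀ b, 0 ≤ H.normalize.w b := H.normalize_w_nonneg hH.w_nonneg
  have hterm : ∀ k : ℕ, (∑ i, (H.normalize.isHermitian_hop U).eigenvalues i ^ (k + 1)) / (k + 1)
      ≤ (∑ i, (H.normalize.isHermitian_hop (free : β → Matrix n n 𝕜)).eigenvalues i ^ (k + 1)) / (k + 1) := by
    intro k
    refine div_le_div_of_nonneg_right ?_ (by positivity)
    rw [← re_trace_pow_eq_sum, ← re_trace_pow_eq_sum]
    exact H.normalize.re_trace_pow_le_free hw hU (k + 1)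
  have hlog : -Real.log (∏ i, (1 - (H.normalize.isHermitian_hop U).eigenvalues i))
      ≤ -Real.log (∏ i, (1 - (H.normalize.isHermitian_hop (free : β → Matrix n n 𝕜)).eigenvalues i)) :=
    hasSum_le hterm hsU hsF
  exact (Real.log_le_log_iff hposF hposU).mp (by linarith)

/-- `det M_U` is real: `det M_U = (Π c) · Π_i(1 − λ_i(U))`.
[cite: BrydgesFrohlichSeiler1979, diamagnetic inequality (lattice Gaussian form, as invoked in Balaban1982Higgs2 (3.38) p.591)] -/
theorem det_coupling_eq_ofReal (hH : H.StrictDom) (U : β → Matrix n n 𝕜) :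
    det (H.coupling U) = (((∏ p : ι × n, H.c p.1) * ∏ i, (1 - (H.normalize.isHermitian_hop U).eigenvalues i) : ℝ) : 𝕜) := by
  rw [H.det_coupling_eq (hH.c_pos H) U, det_one_sub_hop_normalize, RCLike.ofReal_mul, RCLike.ofReal_prod,
    RCLike.ofReal_prod]

/-- **THE DIAMAGNETIC INEQUALITY (determinant form)**: `det M_1 ≤ det M_U`, i.e.
`Re det M_1 ≤ Re det M_U` (both determinants are real and positive).
[cite: BrydgesFrohlichSeiler1979, diamagnetic inequality (lattice Gaussian form, as invoked in Balaban1982Higgs2 (3.38) p.591)] -/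
theorem det_coupling_free_le (hH : H.StrictDom) {U : β → Matrix n n 𝕜} (hU : ∀ b, U b ∈ Matrix.unitaryGroup n 𝕜) :
    RCLike.re (det (H.coupling (free : β → Matrix n n 𝕜))) ≤ RCLike.re (det (H.coupling U)) := by
  rw [H.det_coupling_eq_ofReal hH, H.det_coupling_eq_ofReal hH, RCLike.ofReal_re, RCLike.ofReal_re]
  exact mul_le_mul_of_nonneg_left (H.prod_one_sub_eigenvalues_free_le hH hU)
    (Finset.prod_nonneg fun p _ => (hH.c_pos H p.1).le)

/-- The imaginary part of `det M_U` vanishes.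
[cite: BrydgesFrohlichSeiler1979, diamagnetic inequality (lattice Gaussian form, as invoked in Balaban1982Higgs2 (3.38) p.591)] -/
theorem im_det_coupling (hH : H.StrictDom) (U : β → Matrix n n 𝕜) : RCLike.im (det (H.coupling U)) = 0 := by
  rw [H.det_coupling_eq_ofReal hH, RCLike.ofReal_im]

/-- `0 < det M_U`.
[cite: BrydgesFrohlichSeiler1979, diamagnetic inequality (lattice Gaussian form, as invoked in Balaban1982Higgs2 (3.38) p.591)] -/
theorem det_coupling_pos (hH : H.StrictDom) {U : β → Matrix n n 𝕜} (hU : ∀ b, U b ∈ Matrix.unitaryGroup n 𝕜) :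
    0 < det (H.coupling U) :=
  (H.posDef_coupling hH hU).det_pos

end Hopping

/-! ## §6. The real (orthogonal) case: `det M_1 ≤ det M_U` as real numbers -/

namespace Hopping

variable {ι β n : Type*} [Fintype ι] [Fintype β] [Fintype n] [DecidableEq ι] [DecidableEq n]
variable (H : Hopping ι β)

/-- **THE DIAMAGNETIC INEQUALITY, real orthogonal link variables** (the case of [Balaban1982Higgs1]'s
`U(A_b) = exp(eεqA_b) ∈ O(N)`): `0 < det M_1 ≤ det M_U` for every `U : β → O(n)`, under strict diagonal dominance
(`m² > 0`); together with `∫_{ℝ^{ι×n}} e^{−½⟨φ,Mφ⟩}dφ = (2π)^{|ι×n|/2}(det M)^{−1/2}` this is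
`∫ e^{−½⟨φ,M_Uφ⟩} ≤ ∫ e^{−½⟨φ,M_1φ⟩}`, the form invoked at [Balaban1982Higgs2] (3.37)–(3.38) p. 591.
[cite: Balaban1982Higgs2, (3.38) p.591] -/
theorem det_coupling_free_le_real (hH : H.StrictDom) {U : β → Matrix n n ℝ}
    (hU : ∀ b, U b ∈ Matrix.unitaryGroup n ℝ) :
    det (H.coupling (free : β → Matrix n n ℝ)) ≤ det (H.coupling U) := by
  have := H.det_coupling_free_le hH hU
  simpa only [RCLike.re_to_real] using this

/-- Positivity in the real case: `M_U` is positive definite and `0 < det M_U`.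
[cite: BrydgesFrohlichSeiler1979, diamagnetic inequality (lattice Gaussian form, as invoked in Balaban1982Higgs2 (3.38) p.591)] -/
theorem posDef_coupling_real (hH : H.StrictDom) {U : β → Matrix n n ℝ} (hU : ∀ b, U b ∈ Matrix.unitaryGroup n ℝ) :
    (H.coupling U).PosDef ∧ 0 < det (H.coupling U) :=
  ⟨H.posDef_coupling hH hU, H.det_coupling_pos hH hU⟩

end Hopping

end Literature.MathematicalPhysics.QuantumFieldTheory.LatticeDiamagneticInequality
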